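import Summits.MatrixMultiplication.OmegaCensus.STPPSmallPatternKernelSearch122R
import Summits.MatrixMultiplication.OmegaCensus.STPPSmallPatternKernelProduct

/-!
# ω-census, `(1,2,2)^4` is infeasible in `ℤ/32` — pruned kernel search, part 21

HONEST FRAMING (pub-omega census; verbatim): lottery ticket; floor = certified bounds/negative ranges.
Census STRUCTURE bookkeeping of the STPP track (seat pub-omega-stpp-3, gen 25; STRUCTURE row B5, the threshold column
`T2(H) = max {k : (1,2,2)^k ⊆ H}`, lower side), not progress on `ω`: small patterns in small groups bound no exponent.

Chunks of `STPP122Neg.search2r (zcode 32) 4` (`decide +kernel`, ≈ 247 s predicted): entries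
`(y, c'₀, xb, xb2, XB, XC, PP)` = fixed start, exclusion masks on the codes of `b₁`, `b'₁`, and the forbidden
difference masks of the start's pair-class rank (`STPPSmallPatternKernelReflect122R.lean`); assembled in `STPPSmallPatternNone122K4Z32.lean`.

References: H. Cohn, R. Kleinberg, B. Szegedy, C. Umans, FOCS 2005 (arXiv:math/0511460), Def. 5.1.
-/

set_option Elab.async false
set_option synthInstance.maxSize 8192
set_option synthInstance.maxHeartbeats 800000

namespace Summit.MatrixMultiplication.OmegaCensus

namespace STPP122Neg

open STPP211Neg

/-- Pruned kernel search (min-flag normal form), `ℤ/32`, `k = 4`, start `(y, c'₀) = (1, 8)`: b₁ ∈ [7, 10, 11, 12, 13, 14, 15, 16]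
(≈ 118 s predicted). -/
theorem Z32k4r.x54 : search2r (zcode 32) 4
    [(1, 8, 4294837119, 0, 0, 0, 18686967465153924738903910972938764505743824091134693994976432132411126385736101511135744942826772590814387649333576562383972813350200398179273460998427482024735772808728714806557867978756984431477751621475351832396076062468179210166966713722839278205136331963707552338747950230971146357315728342780070592512)] = true := by
  decide +kernel

/-- Pruned kernel search (min-flag normal form), `ℤ/32`, `k = 4`, start `(y, c'₀) = (1, 8)`: b₁ ∈ [17, 18, 19, 20, 21, 22, 23, 26, 27, 28, 29, 30]
(≈ 26 s predicted). -/
theorem Z32k4r.x55 : search2r (zcode 32) 4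
    [(1, 8, 2197946367, 0, 0, 0, 18686967465153924738903910972938764505743824091134693994976432132411126385736101511135744942826772590814387649333576562383972813350200398179273460998427482024735772808728714806557867978756984431477751621475351832396076062468179210166966713722839278205136331963707552338747950230971146357315728342780070592512)] = true := by
  decide +kernel

/-- Pruned kernel search (min-flag normal form), `ℤ/32`, `k = 4`, start `(y, c'₀) = (1, 24)`: b₁ ∈ [2, 3]
(≈ 103 s predicted). -/
theorem Z32k4r.x56 : search2r (zcode 32) 4
    [(1, 24, 2097151216, 0, 0, 0, 18686967465153924738903910972938764505743824091134693994976432132411126385736101511135744942826772590814387649333576562383972813350200398179273460998427482024735772808728714806557867978756984431477751621475351832396076062468179210166966713722839278205136331963707552338747950230971146357315728342780070592512)] = true := by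
  decide +kernel

end STPP122Neg

end Summit.MatrixMultiplication.OmegaCensus
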